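import Mathlib.Analysis.MellinTransform
import Mathlib.NumberTheory.LSeries.RiemannZeta
import Mathlib.Analysis.Distribution.SchwartzSpace.Deriv
import Mathlib.MeasureTheory.Integral.IntegralEqImproper
import Mathlib.MeasureTheory.Measure.Lebesgue.Integral
import Literature.NumberTheory.LFunctions.MuentzFormulaStrip
import Literature.NumberTheory.Automorphic.MeyerThetaMellin
import HarnessLib

/-!
# Müntz's formula in the critical strip for Schwartz data, and Connes' `𝓔` on Schwartz functions

Topic `Literature/NumberTheory/LFunctions` (sequel of `MuentzFormula.lean` / `MuentzFormulaStrip.lean`,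
which treat `Re s > 1` and compactly supported Lipschitz data).  Everything in this file is PROVED;
there are no named facts.  RH-FREE (no positivity, nothing about zeros off the line).

Müntz's formula (Titchmarsh §2.11, (2.11.1)) in the case `∫_0^∞ F = 0`, for a Schwartz function `F`:
`∫_0^∞ x^{s-1} Σ_{n ≥ 1} F(n x) dx = ζ(s) ∫_0^∞ x^{s-1} F(x) dx` for all `Re s > 0`, `s ≠ 1`, both Mellin
integrals converging absolutely.  The only input beyond `MuentzFormulaStrip.lean` is the
**Riemann-sum estimate for Schwartz (indeed `W^{1,1}`) data**:
`‖x Σ_{n ≥ 1} F(n x) − ∫_0^∞ F‖ ≤ x ∫_0^∞ ‖F'‖` (`norm_mul_tsum_schwartz_sub_integral_le`) — on each cell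
`[(n-1)x, nx]` one has `‖F(nx) − F(t)‖ ≤ ∫_{cell} ‖F'‖` — so that `G(x) = Σ_{n ≥ 1} F(nx)` is BOUNDED on
`(0, ∞)` when `∫_0^∞ F = 0` (this is Connes–Consani 2023, Lemma 6.1 (i), proof p0018:L26–L51, in the
smooth case), i.e. the abstract continuation `mellin_tsum_comp_mul_nat_of_isBigO` applies with `b = 0`.

* `hasSum_setIntegral_Ioc_mul_nat` — `Σ_n ∫_{[nx,(n+1)x]} g = ∫_0^∞ g` for integrable `g`.
* `norm_mul_tsum_schwartz_sub_integral_le`, `norm_tsum_schwartz_le_of_integral_eq_zero`.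
* `isBigO_atTop_tsum_schwartz_comp_mul_nat` — `G = O(x^{-k})` at `∞` for every `k ≥ 2`.
* **`mellin_tsum_schwartz_comp_mul_nat`** — Müntz for Schwartz `F` with `∫_0^∞ F = 0`, `Re s > 0`, `s ≠ 1`.
* **`mellin_connesE_schwartz`** — for a real Schwartz `f` with `∫_0^∞ f = 0`:
  `∫_0^∞ 𝓔(f)(u) u^{s-1} du = ζ(s + ½) ∫_0^∞ f(x) x^{s - ½} dx` for `Re s > −½`, `s ≠ ½`, with absolute
  convergence — eq. (𝓔 ζ) of the proof of Connes–Consani 2023, Thm 6.4 (arXiv:2106.01715, p0019:L68),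
  and the Schwartz-class case left open in the docstring of `MuentzFormulaStrip.lean`.
* `integral_Ioi_eq_zero_of_even` — for even `f` with `∫_ℝ f = 0`, `∫_0^∞ f = 0` (the class `𝒮^ev_0`).

No definitions (the complexification of a real Schwartz function is Mathlib's
`SchwartzMap.postcompCLM Complex.ofRealCLM`, used inline).

## References

* E. C. Titchmarsh, *The Theory of the Riemann Zeta-Function*, 2nd ed., Oxford 1986, §2.11 (2.11.1)
  [Titchmarsh1986].
* A. Connes, C. Consani, *Spectral triples and ζ-cycles*, Enseign. Math. 69 (2023) 93–148,
  arXiv:2106.01715, §6, Lemma 6.1 and proof of Theorem 6.4 [ConnesConsani2023].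
-/

noncomputable section

open scoped Topology SchwartzMap Interval
open Function Real Complex Set MeasureTheory Filter Asymptotics intervalIntegral
open Literature.NumberTheory.Automorphic.Meyer (schwartz_isBigO_atTop_rpow_neg schwartz_isBigO_nhdsGT_zero
  mellinConvergent_schwartz summable_schwartz_comp_nat_mul)

namespace Literature.NumberTheory.LFunctions

/-! ### Cells `((n x, (n+1) x]` tile `(0, ∞)` -/

/-- For `x > 0` the cells `(n x, (n+1) x]`, `n ∈ ℕ`, are pairwise disjoint. [folklore] -/
private theorem pairwise_disjoint_Ioc_mul_nat {x : ℝ} (hx : 0 < x) :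
    Pairwise (Disjoint on fun n : ℕ => Ioc ((n : ℝ) * x) (((n : ℝ) + 1) * x)) := by
  intro m n hmn
  rcases lt_or_gt_of_ne hmn with h | h
  · refine Set.disjoint_left.2 fun t htm htn => ?_
    have h1 : ((m : ℝ) + 1) * x ≤ (n : ℝ) * x := by
      gcongr; exact_mod_cast Nat.succ_le_of_lt h
    exact absurd (lt_of_lt_of_le (lt_of_le_of_lt h1 htn.1) (le_refl _)) (not_lt.2 htm.2)
  · refine Set.disjoint_left.2 fun t htm htn => ?_
    have h1 : ((n : ℝ) + 1) * x ≤ (m : ℝ) * x := by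
      gcongr; exact_mod_cast Nat.succ_le_of_lt h
    exact absurd (lt_of_le_of_lt h1 htm.1) (not_lt.2 htn.2)

/-- For `x > 0`, `⋃_n (n x, (n+1) x] = (0, ∞)`. [folklore] -/
private theorem iUnion_Ioc_mul_nat {x : ℝ} (hx : 0 < x) :
    (⋃ n : ℕ, Ioc ((n : ℝ) * x) (((n : ℝ) + 1) * x)) = Ioi 0 := by
  ext t
  simp only [mem_iUnion, mem_Ioc, mem_Ioi]
  constructor
  · rintro ⟨n, hn, -⟩
    exact lt_of_le_of_lt (by positivity) hn
  · intro ht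
    have hy : 0 < t / x := div_pos ht hx
    obtain ⟨N, hN⟩ : ∃ N : ℕ, ⌈t / x⌉₊ = N + 1 :=
      Nat.exists_eq_add_one_of_ne_zero (Nat.pos_iff_ne_zero.1 (Nat.ceil_pos.2 hy))
    refine ⟨N, ?_, ?_⟩
    · have h1 : (⌈t / x⌉₊ : ℝ) < t / x + 1 := Nat.ceil_lt_add_one hy.le
      rw [hN] at h1
      push_cast at h1
      have h2 : (N : ℝ) < t / x := by linarith
      exact (lt_div_iff₀ hx).1 h2
    · have h1 : t / x ≤ (⌈t / x⌉₊ : ℝ) := Nat.le_ceil _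
      rw [hN] at h1
      push_cast at h1
      exact (div_le_iff₀ hx).1 h1

/-- For `g` integrable on `(0, ∞)` and `x > 0`: `Σ_n ∫_{(nx,(n+1)x]} g = ∫_0^∞ g` (as a `HasSum`) — the
decomposition `∫_0^∞ = Σ_n ∫_{nu}^{(n+1)u}` used in the proof of Connes–Consani 2023, Lemma 6.1 (i)
(p0018:L26–L38). [cite: ConnesConsani2023, Lemma 6.1 (i), proof (arXiv chunk p0018:L26–L38)] -/
theorem hasSum_setIntegral_Ioc_mul_nat {E : Type*} [NormedAddCommGroup E] [NormedSpace ℝ E]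
    {g : ℝ → E} (hg : IntegrableOn g (Ioi 0)) {x : ℝ} (hx : 0 < x) :
    HasSum (fun n : ℕ => ∫ t in Ioc ((n : ℝ) * x) (((n : ℝ) + 1) * x), g t) (∫ t in Ioi 0, g t) := by
  have h := hasSum_integral_iUnion (μ := volume) (f := g)
    (s := fun n : ℕ => Ioc ((n : ℝ) * x) (((n : ℝ) + 1) * x)) (fun n => measurableSet_Ioc)
    (pairwise_disjoint_Ioc_mul_nat hx) (by rwa [iUnion_Ioc_mul_nat hx])
  rwa [iUnion_Ioc_mul_nat hx] at h

/-! ### The Riemann-sum estimate for Schwartz functions -/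

/-- The derivative of a Schwartz function is integrable (it is again Schwartz). [folklore] -/
private theorem integrable_deriv_schwartz (F : 𝓢(ℝ, ℂ)) : Integrable (deriv (⇑F)) := by
  have h : (⇑(SchwartzMap.derivCLM ℝ ℂ F) : ℝ → ℂ) = deriv (⇑F) := by
    funext x; exact SchwartzMap.derivCLM_apply ℝ F x
  rw [← h]
  exact (SchwartzMap.derivCLM ℝ ℂ F).integrable

/-- The derivative of a Schwartz function is continuous. [folklore] -/
private theorem continuous_deriv_schwartz (F : 𝓢(ℝ, ℂ)) : Continuous (deriv (⇑F)) := by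
  have h : (⇑(SchwartzMap.derivCLM ℝ ℂ F) : ℝ → ℂ) = deriv (⇑F) := by
    funext x; exact SchwartzMap.derivCLM_apply ℝ F x
  rw [← h]
  exact (SchwartzMap.derivCLM ℝ ℂ F).continuous

/-- **One cell.**  For a Schwartz `F` and `a ≤ b`:
`‖(b − a) F(b) − ∫_a^b F‖ ≤ (b − a) ∫_a^b ‖F'‖` (since `‖F(b) − F(t)‖ ≤ ∫_a^b ‖F'‖` on the cell) — the
smooth case of the cell estimate `|∫_{nu}^{(n+1)u}((n+1)u − t) df(t)| ≤ u ∫_{nu}^{(n+1)u} |df|` in the proof of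
Connes–Consani 2023, Lemma 6.1 (i) (p0018:L32–L43).
[cite: ConnesConsani2023, Lemma 6.1 (i), proof (arXiv chunk p0018:L32–L43)] -/
theorem norm_mul_sub_integral_cell_le (F : 𝓢(ℝ, ℂ)) {a b : ℝ} (hab : a ≤ b) :
    ‖((b - a : ℝ) : ℂ) * F b - ∫ t in a..b, F t‖ ≤ (b - a) * ∫ t in a..b, ‖deriv (⇑F) t‖ := by
  have hcont : Continuous (⇑F) := F.continuous
  have hD : Continuous (deriv (⇑F)) := continuous_deriv_schwartz F
  set D : ℝ := ∫ t in a..b, ‖deriv (⇑F) t‖ with hD_def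
  -- the bound on the cell
  have hbound : ∀ t ∈ Ι a b, ‖F b - F t‖ ≤ D := by
    intro t ht
    rw [uIoc_of_le hab] at ht
    have hFTC : ∫ y in t..b, deriv (⇑F) y = F b - F t :=
      integral_eq_sub_of_hasDerivAt (fun y _ => F.hasDerivAt y) (hD.intervalIntegrable _ _)
    rw [← hFTC]
    calc ‖∫ y in t..b, deriv (⇑F) y‖ ≤ ∫ y in t..b, ‖deriv (⇑F) y‖ :=
          norm_integral_le_integral_norm ht.2
      _ ≤ D := by
          refine integral_mono_interval ht.1.le ht.2 le_rfl ?_ (hD.norm.intervalIntegrable _ _)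
          exact Eventually.of_forall fun y => norm_nonneg _
  have hrw : ((b - a : ℝ) : ℂ) * F b - ∫ t in a..b, F t = ∫ t in a..b, (F b - F t) := by
    rw [intervalIntegral.integral_sub intervalIntegrable_const (hcont.intervalIntegrable _ _),
      intervalIntegral.integral_const, Complex.real_smul]
  rw [hrw]
  have h := norm_integral_le_of_norm_le_const (a := a) (b := b) (C := D)
    (f := fun t => F b - F t) hbound
  rw [abs_of_nonneg (sub_nonneg.2 hab)] at h
  linarith [h]

/-- **Riemann-sum estimate for Schwartz functions.**  For `x > 0`,
`‖x Σ_{n ≥ 1} F(n x) − ∫_0^∞ F‖ ≤ x ∫_0^∞ ‖F'‖` (sum the one-cell estimates over the cells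
`((n-1)x, nx]`, which tile `(0, ∞)`).  This is the smooth case of the Stieltjes estimate
`|u Σ f(nu) − ∫ f| ≤ u ∫ |df|` in the proof of Connes–Consani 2023, Lemma 6.1 (i) (p0018:L26–L48).
[cite: ConnesConsani2023, Lemma 6.1 (i), proof (arXiv chunk p0018:L26–L48)] -/
theorem norm_mul_tsum_schwartz_sub_integral_le (F : 𝓢(ℝ, ℂ)) {x : ℝ} (hx : 0 < x) :
    ‖(x : ℂ) * ∑' n : ℕ, F (((n + 1 : ℕ) : ℝ) * x) - ∫ t in Ioi 0, F t‖
      ≤ x * ∫ t in Ioi 0, ‖deriv (⇑F) t‖ := by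
  -- the three summable families: cell integrals of `F`, of `‖F'‖`, and the samples `x F((n+1)x)`
  have ha : HasSum (fun n : ℕ => ∫ t in Ioc ((n : ℝ) * x) (((n : ℝ) + 1) * x), F t)
      (∫ t in Ioi 0, F t) :=
    hasSum_setIntegral_Ioc_mul_nat F.integrable.integrableOn hx
  have hd : HasSum (fun n : ℕ => ∫ t in Ioc ((n : ℝ) * x) (((n : ℝ) + 1) * x), ‖deriv (⇑F) t‖)
      (∫ t in Ioi 0, ‖deriv (⇑F) t‖) :=
    hasSum_setIntegral_Ioc_mul_nat (integrable_deriv_schwartz F).norm.integrableOn hx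
  have hb : HasSum (fun n : ℕ => (x : ℂ) * F (((n + 1 : ℕ) : ℝ) * x))
      ((x : ℂ) * ∑' n : ℕ, F (((n + 1 : ℕ) : ℝ) * x)) :=
    (summable_schwartz_comp_nat_mul F hx).hasSum.mul_left _
  rw [← (hb.sub ha).tsum_eq]
  refine tsum_of_norm_bounded (hd.mul_left x) fun n => ?_
  -- one cell: endpoints `a = n x ≤ b = (n+1) x`, `b - a = x`
  have hle : (n : ℝ) * x ≤ ((n : ℝ) + 1) * x := by nlinarith
  have hcell := norm_mul_sub_integral_cell_le F hle
  have hlen : ((n : ℝ) + 1) * x - (n : ℝ) * x = x := by ring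
  rw [hlen, intervalIntegral.integral_of_le hle, intervalIntegral.integral_of_le hle] at hcell
  have hcast : (((n + 1 : ℕ) : ℝ)) * x = ((n : ℝ) + 1) * x := by push_cast; ring
  rw [hcast]
  exact hcell

/-- With `∫_0^∞ F = 0`, the sums `Σ_{n ≥ 1} F(n x)` are BOUNDED on `(0, ∞)`:
`‖Σ_{n ≥ 1} F(n x)‖ ≤ ∫_0^∞ ‖F'‖` (Connes–Consani 2023, Lemma 6.1 (i): "`|Σ f(nu)| ≤ ∫_0^∞ |df(t)|`",
p0018:L48, smooth case). [cite: ConnesConsani2023, Lemma 6.1 (i) (arXiv chunk p0018:L48)] -/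
theorem norm_tsum_schwartz_le_of_integral_eq_zero (F : 𝓢(ℝ, ℂ)) (hint : ∫ t in Ioi 0, F t = 0)
    {x : ℝ} (hx : 0 < x) :
    ‖∑' n : ℕ, F (((n + 1 : ℕ) : ℝ) * x)‖ ≤ ∫ t in Ioi 0, ‖deriv (⇑F) t‖ := by
  have h := norm_mul_tsum_schwartz_sub_integral_le F hx
  rw [hint, sub_zero, norm_mul, Complex.norm_real, Real.norm_eq_abs, abs_of_pos hx] at h
  exact le_of_mul_le_mul_left h hx

/-- At infinity `G(x) = Σ_{n ≥ 1} F(n x)` decays like any power: for `k ≥ 2` and `x > 0`,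
`‖G(x)‖ ≤ p_{k,0}(F) · (Σ_{n ≥ 1} n^{-k}) · x^{-k}` where `p_{k,0}` is the Schwartz seminorm
(`‖y‖^k ‖F(y)‖ ≤ p_{k,0}(F)`) — the estimate "`Σ_{n ≥ 1} |f(nu)| ≤ C u^{-N} Σ n^{-N} = C' u^{-N}`" of the
proof of Connes–Consani 2023, Lemma 6.1 (ii) (p0018:L51–L55).
[cite: ConnesConsani2023, Lemma 6.1, proof (arXiv chunk p0018:L51–L55)] -/
theorem norm_tsum_schwartz_comp_mul_nat_le (F : 𝓢(ℝ, ℂ)) {k : ℕ} (hk : 2 ≤ k) {x : ℝ} (hx : 0 < x) :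
    ‖∑' n : ℕ, F (((n + 1 : ℕ) : ℝ) * x)‖
      ≤ SchwartzMap.seminorm ℝ k 0 F * (∑' n : ℕ, 1 / (((n + 1 : ℕ) : ℝ)) ^ k) * (x ^ k)⁻¹ := by
  set C := SchwartzMap.seminorm ℝ k 0 F with hC
  have hC0 : 0 ≤ C := apply_nonneg _ _
  have hsum : HasSum (fun n : ℕ => 1 / (((n + 1 : ℕ) : ℝ)) ^ k) (∑' n : ℕ, 1 / (((n + 1 : ℕ) : ℝ)) ^ k) := by
    have h := (summable_nat_add_iff (f := fun n : ℕ => 1 / ((n : ℝ)) ^ k) 1).mpr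
      (Real.summable_one_div_nat_pow.mpr (by omega))
    exact h.hasSum
  have hg : HasSum (fun n : ℕ => C * (1 / (((n + 1 : ℕ) : ℝ)) ^ k) * (x ^ k)⁻¹)
      (C * (∑' n : ℕ, 1 / (((n + 1 : ℕ) : ℝ)) ^ k) * (x ^ k)⁻¹) :=
    (hsum.mul_left C).mul_right _
  refine tsum_of_norm_bounded hg fun n => ?_
  have hy : 0 < (((n + 1 : ℕ) : ℝ)) * x := mul_pos (by positivity) hx
  have hle := SchwartzMap.le_seminorm ℝ k 0 F ((((n + 1 : ℕ) : ℝ)) * x)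
  rw [norm_iteratedFDeriv_zero, Real.norm_of_nonneg hy.le] at hle
  -- `‖F(y)‖ ≤ C / y^k`, `y = (n+1) x`
  have hyk : 0 < ((((n + 1 : ℕ) : ℝ)) * x) ^ k := pow_pos hy k
  have h1 : ‖F ((((n + 1 : ℕ) : ℝ)) * x)‖ ≤ C / ((((n + 1 : ℕ) : ℝ)) * x) ^ k := by
    rw [le_div_iff₀ hyk, mul_comm]; exact hle
  refine h1.trans (le_of_eq ?_)
  rw [mul_pow]
  field_simp

/-- `G(x) = Σ_{n ≥ 1} F(n x)` is `O(x^{-k})` at `+∞` for every natural `k ≥ 2` ("`𝓔(f)(u)` is of rapid decay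
for `u → ∞`", Connes–Consani 2023, Lemma 6.1 (i)/(ii), proof p0018:L51–L57).
[cite: ConnesConsani2023, Lemma 6.1, proof (arXiv chunk p0018:L51–L57)] -/
theorem isBigO_atTop_tsum_schwartz_comp_mul_nat (F : 𝓢(ℝ, ℂ)) {k : ℕ} (hk : 2 ≤ k) :
    (fun x : ℝ => ∑' n : ℕ, F (((n + 1 : ℕ) : ℝ) * x)) =O[atTop] fun x : ℝ => x ^ (-(k : ℝ)) := by
  set A := SchwartzMap.seminorm ℝ k 0 F * (∑' n : ℕ, 1 / (((n + 1 : ℕ) : ℝ)) ^ k) with hA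
  refine IsBigO.of_bound A ?_
  filter_upwards [eventually_gt_atTop (0 : ℝ)] with x hx
  have h := norm_tsum_schwartz_comp_mul_nat_le F hk hx
  have hxk : x ^ (-(k : ℝ)) = (x ^ k)⁻¹ := by
    rw [Real.rpow_neg hx.le, Real.rpow_natCast]
  rw [Real.norm_of_nonneg (by rw [hxk]; positivity), hxk]
  exact h

/-- With `∫_0^∞ F = 0`, `G(x) = Σ_{n ≥ 1} F(n x)` is `O(1) = O(x^{-0})` at `0⁺` (Connes–Consani 2023,
Lemma 6.1 (i): `|Σ_n f(nu)| ≤ ∫_0^∞ |df|`, p0018:L48, smooth case).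
[cite: ConnesConsani2023, Lemma 6.1 (i) (arXiv chunk p0018:L48)] -/
theorem isBigO_nhdsGT_tsum_schwartz_comp_mul_nat (F : 𝓢(ℝ, ℂ)) (hint : ∫ t in Ioi 0, F t = 0) :
    (fun x : ℝ => ∑' n : ℕ, F (((n + 1 : ℕ) : ℝ) * x)) =O[𝓝[>] (0 : ℝ)] fun x : ℝ => x ^ (-(0 : ℝ)) := by
  refine IsBigO.of_bound (∫ t in Ioi 0, ‖deriv (⇑F) t‖) ?_
  filter_upwards [self_mem_nhdsWithin] with x hx
  rw [neg_zero, Real.rpow_zero, norm_one, mul_one]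
  exact norm_tsum_schwartz_le_of_integral_eq_zero F hint hx

/-! ### Müntz's formula for Schwartz data with vanishing integral -/

/-- **Müntz's formula (2.11.1), case `∫_0^∞ F = 0`, Schwartz data.**  For a Schwartz function `F` with
`∫_0^∞ F = 0` and every `s ≠ 1` with `Re s > 0`: the Mellin transform of `G(x) = Σ_{n ≥ 1} F(n x)`
converges absolutely at `s` and `∫_0^∞ G(x) x^{s-1} dx = ζ(s) ∫_0^∞ F(x) x^{s-1} dx`
(Titchmarsh §2.11; `G` is bounded near `0` by the Riemann-sum estimate and decays like any power at
`∞`, so the tree's `mellin_tsum_comp_mul_nat_of_isBigO` applies with `b = 0`).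
[cite: Titchmarsh1986, §2.11 (2.11.1)] -/
theorem mellin_tsum_schwartz_comp_mul_nat (F : 𝓢(ℝ, ℂ)) (hint : ∫ t in Ioi 0, F t = 0)
    {s : ℂ} (hs : 0 < s.re) (hs1 : s ≠ 1) :
    MellinConvergent (fun x : ℝ => ∑' n : ℕ, F (((n + 1 : ℕ) : ℝ) * x)) s ∧
      mellin (fun x : ℝ => ∑' n : ℕ, F (((n + 1 : ℕ) : ℝ) * x)) s
        = riemannZeta s * mellin (fun x : ℝ => F x) s := by
  -- an integer exponent `k ≥ 2` with `Re s < k`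
  obtain ⟨k, hk2, hsk⟩ : ∃ k : ℕ, 2 ≤ k ∧ s.re < k := by
    refine ⟨⌈s.re⌉₊ + 2, by omega, ?_⟩
    have h := Nat.le_ceil s.re
    push_cast
    linarith
  have hk1 : (1 : ℝ) < k := by exact_mod_cast (lt_of_lt_of_le one_lt_two hk2)
  have hF_int : LocallyIntegrableOn (fun x : ℝ => F x) (Ioi 0) :=
    F.continuous.locallyIntegrable.locallyIntegrableOn _
  have hF_top : (fun x : ℝ => F x) =O[atTop] fun x : ℝ => x ^ (-(k : ℝ)) :=
    schwartz_isBigO_atTop_rpow_neg F k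
  have hF_bot : (fun x : ℝ => F x) =O[𝓝[>] (0 : ℝ)] fun x : ℝ => x ^ (-(0 : ℝ)) :=
    schwartz_isBigO_nhdsGT_zero F
  have hG_int : LocallyIntegrableOn (fun x : ℝ => ∑' n : ℕ, F (((n + 1 : ℕ) : ℝ) * x)) (Ioi 0) :=
    locallyIntegrableOn_tsum_comp_mul_nat (fun x : ℝ => F x) (s := 2) (by norm_num)
      (mellinConvergent_schwartz F (by norm_num))
  have hG_top := isBigO_atTop_tsum_schwartz_comp_mul_nat F hk2
  have hG_bot := isBigO_nhdsGT_tsum_schwartz_comp_mul_nat F hint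
  refine ⟨mellinConvergent_of_isBigO_rpow hG_int hG_top hsk hG_bot (by simpa using hs), ?_⟩
  exact mellin_tsum_comp_mul_nat_of_isBigO hk1 hF_int hF_top hF_bot hG_int hG_top hG_bot
    (by simpa using hs) hsk hs1

/-! ### Even functions with vanishing integral -/

/-- For an integrable even function `f : ℝ → E` with `∫_ℝ f = 0` one has `∫_0^∞ f = 0`
(`∫_ℝ f = 2 ∫_0^∞ f`); this is how the defining condition `∫ f(x) dx = 0` of `𝒮^ev_0` (Connes–Consani
2023, §6.1, p0018:L20) yields Lemma 6.1's hypothesis `∫_0^∞ f = 0` ("one easily checks that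
`∫_0^∞ f(x) dx = 0`", proof of Theorem 6.4 (i), p0019:L30).
[cite: ConnesConsani2023, §6.1 and proof of Theorem 6.4 (i) (arXiv chunks p0018:L20, p0019:L30)] -/
theorem integral_Ioi_eq_zero_of_even {E : Type*} [NormedAddCommGroup E] [NormedSpace ℝ E]
    {f : ℝ → E} (hf : Integrable f) (heven : ∀ x, f (-x) = f x) (h : ∫ x, f x = 0) :
    ∫ x in Ioi 0, f x = 0 := by
  have h1 : ∫ x in Iic (0 : ℝ), f x = ∫ x in Ioi 0, f x := by
    have h2 : ∫ x in Iic (0 : ℝ), f (-x) = ∫ x in Ioi (-0 : ℝ), f x := integral_comp_neg_Iic 0 f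
    simp only [heven, neg_zero] at h2
    exact h2
  have h3 := integral_Iic_add_Ioi (μ := volume) (f := f) (b := 0) hf.integrableOn hf.integrableOn
  rw [h1, h, ← two_smul ℝ] at h3
  exact (smul_eq_zero.1 h3).resolve_left two_ne_zero

/-! ### Connes' `𝓔` on Schwartz functions, across the critical line -/

/-- **Connes' `𝓔` across the critical line, Schwartz class** (Connes–Consani 2023, proof of
Theorem 6.4, eq. (𝓔 ζ), p0019:L52–L89: "`∫ 𝓔(f)(u) u^{-iz} d^*u = ζ(½ − iz) ψ(z)` … holds when `z ∈ ℝ`";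
Müntz (2.11.1)): for a real Schwartz function `f` with `∫_0^∞ f = 0` and every `s` with `Re s > −½`,
`s ≠ ½`, the Mellin transform of `𝓔(f)(u) = u^{1/2} Σ_{n ≥ 1} f(n u)` converges absolutely at `s` and
`∫_0^∞ 𝓔(f)(u) u^{s-1} du = ζ(s + ½) ∫_0^∞ f(x) x^{s - ½} dx`.
[cite: ConnesConsani2023, proof of Theorem 6.4, eq. (𝓔 ζ) (arXiv chunk p0019:L52–L89)] -/
theorem mellin_connesE_schwartz (f : 𝓢(ℝ, ℝ)) (hint : ∫ t in Ioi 0, f t = 0)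
    {s : ℂ} (hs : -(1 / 2 : ℝ) < s.re) (hs1 : s ≠ 1 / 2) :
    MellinConvergent (fun u ↦ (connesE f u : ℂ)) s ∧
      mellin (fun u ↦ (connesE f u : ℂ)) s =
        riemannZeta (s + 1 / 2) * mellin (fun x ↦ ((f x : ℝ) : ℂ)) (s + 1 / 2) := by
  set F : 𝓢(ℝ, ℂ) := SchwartzMap.postcompCLM Complex.ofRealCLM f with hF_def
  have hFx : ∀ x, F x = ((f x : ℝ) : ℂ) := fun x => rfl
  have hFint : ∫ t in Ioi 0, F t = 0 := by
    simp only [hFx, integral_complex_ofReal, hint, Complex.ofReal_zero]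
  have hs' : 0 < (s + 1 / 2).re := by
    simp only [add_re, one_div]
    norm_num
    linarith
  have hs1' : s + 1 / 2 ≠ 1 := by
    intro h; apply hs1; linear_combination h
  obtain ⟨hconv, heq⟩ := mellin_tsum_schwartz_comp_mul_nat F hFint hs' hs1'
  have hEq : EqOn (fun u : ℝ ↦ (connesE f u : ℂ))
      (fun u ↦ (u : ℂ) ^ ((1 / 2 : ℂ)) • ∑' n : ℕ, F (((n + 1 : ℕ) : ℝ) * u)) (Ioi 0) := by
    intro u hu
    simp only [hFx]
    exact connesE_ofReal_eq hu
  refine ⟨?_, ?_⟩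
  · have h1 : MellinConvergent
        (fun u : ℝ ↦ (u : ℂ) ^ ((1 / 2 : ℂ)) • ∑' n : ℕ, F (((n + 1 : ℕ) : ℝ) * u)) s :=
      MellinConvergent.cpow_smul.mpr hconv
    rw [MellinConvergent] at h1 ⊢
    refine (integrableOn_congr_fun ?_ measurableSet_Ioi).mpr h1
    intro u hu
    simp only [hEq hu]
  · have hmF : mellin (fun x ↦ ((f x : ℝ) : ℂ)) (s + 1 / 2) = mellin (fun x ↦ F x) (s + 1 / 2) := by
      simp only [hFx]
    rw [hmF, ← heq, ← mellin_cpow_smul]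
    exact setIntegral_congr_fun measurableSet_Ioi fun u hu ↦ by simp only [hEq hu]

end Literature.NumberTheory.LFunctions
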